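import Mathlib
import Summits.Ventures.PercRepro2.Defs
import Summits.Ventures.PercRepro2.Independence
import Summits.Ventures.PercRepro2.Harris
import Summits.Ventures.PercRepro2.Graph
import Summits.Ventures.PercRepro2.HullDefs
import Summits.Ventures.PercRepro2.HullFlip
import Summits.Ventures.PercRepro2.HullPieceFlip

/-!
# Row (SW-side): the switch form of the weight-free base with `h` on a side of `l`'s hull is a
theorem (blind cell PercRepro2, night-4 g4, 2026-08-24; proofs/NIGHT4-SIDE.md)

Free fibre (uniform 2-colouring, blue = `Hull.blue ζ`), marks `l, h, o`, `A = C_R(l)`, `B = C_B(l)`.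
Row (SW) (the weight-free base, `LocRows.Sw_all`) compares the two clusters of `h` on
`{h ∉ A ∪ B, o ∈ R_side}`.  Its companion with `h` ON A SIDE of the hull of `l` is a theorem, for
EVERY family `𝓥` of vertex sets (no up-set hypothesis):
* `card_oneSided_le`: `#{o ∈ B, h ∈ A ∖ B, C_B(h) ∈ 𝓥} ≤ #{o ∈ A, h ∈ A ∖ B, C_B(h) ∈ 𝓥}`;
* `card_side_le` (row (SW-side)): `#{o ∈ R_side, h ∈ B_side, C_R(h) ∈ 𝓥} ≤ #{o ∈ R_side, h ∈ R_side, C_B(h) ∈ 𝓥}`.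

PROOF.  Group the configurations by the DATUM of the blue cluster `S = C_B(h)` — its colouring on the
edges touching `S` (`datum`); the classes are cylinders (`fib`, domain Markov `cluster_eq_of_eqOn_touches`)
carrying the product law `pin` (touching edges pinned, fair coins elsewhere).  On a class with `l ∉ S`
the events `{o ∈ A}`, `{h ∈ A}` are increasing and `{o ∈ B}` is decreasing, so Harris on the class
(`cnt_mul_cnt_le_of_upper`, `cnt_le_cnt_mul_cnt_of_lower`) gives
`#{o∈B, h∈A}·2^k ≤ #{o∈B}·#{h∈A} ≤ #{o∈A}·#{h∈A} ≤ #{o∈A, h∈A}·2^k`, the middle step being the colour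
swap OFF the edges touching `S` (`swapOff`): a blue path from `l ∉ S` never touches `S` and turns red
(`conn_of_eqOn_off_touches`).  Sum over the classes with `S ∈ 𝓥`.  With mine-2's cluster-swap
domination (`Ser.card_clusterFamily_le`, the same with `h ∉ B` only) this is the identity
(SW) = (TOT) − (SW-side): the open content of the weight-free base is the class `h ∉ A ∪ B` alone.
-/

namespace Summit.Ventures.PercRepro2

namespace SwSide

open Hull

open scoped Classical

variable {V : Type*} {E : Type*} [Fintype E] [DecidableEq E]

/-! ## Pinned product laws: a cylinder carries fair coins off the pinned edges -/
/-- The product law that pins the edges of `F` to the colours of `ζ₀` and is a fair coin elsewhere. -/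
noncomputable def pin (ζ₀ : Config E) (F : Finset E) : E → ℚ :=
  fun e => if e ∈ F then (if ζ₀ e then 1 else 0) else 1 / 2

omit [Fintype E] in
/-- `pin` is an admissible weight vector. -/
lemma isProbVec_pin (ζ₀ : Config E) (F : Finset E) : IsProbVec (pin ζ₀ F) := by
  refine ⟨fun e => ?_, fun e => ?_⟩ <;> unfold pin <;> split_ifs <;> norm_num

/-- The cylinder of `ζ₀` on `F`, as a Finset. -/
noncomputable def fib (ζ₀ : Config E) (F : Finset E) : Finset (Config E) :=
  Finset.univ.filter fun ζ => ∀ e ∈ F, ζ e = ζ₀ e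

/-- The number of configurations of the cylinder of `ζ₀` on `F` lying in `A`. -/
noncomputable def cnt (ζ₀ : Config E) (F : Finset E) (A : Set (Config E)) : ℕ :=
  ((fib ζ₀ F).filter fun ζ => ζ ∈ A).card

/-- The weight of `pin`: `(1/2)^{|Fᶜ|}` on the cylinder, `0` off it. -/
lemma weight_pin (ζ₀ : Config E) (F : Finset E) (ζ : Config E) :
    weight (pin ζ₀ F) ζ = if (∀ e ∈ F, ζ e = ζ₀ e) then ((1 / 2 : ℚ) ^ Fᶜ.card) else 0 := by
  unfold weight
  rw [← Finset.prod_mul_prod_compl F]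
  have h1 : ∀ e ∈ F, edgeFactor (pin ζ₀ F e) (ζ e) = if ζ e = ζ₀ e then (1 : ℚ) else 0 := by
    intro e he; simp only [pin, he, if_true]
    cases ζ₀ e <;> cases ζ e <;> simp [edgeFactor]
  have h2 : ∀ e ∈ Fᶜ, edgeFactor (pin ζ₀ F e) (ζ e) = (1 / 2 : ℚ) := by
    intro e he; rw [Finset.mem_compl] at he; simp only [pin, he, if_false]
    cases ζ e <;> norm_num [edgeFactor]
  rw [Finset.prod_congr rfl h1, Finset.prod_congr rfl h2, Finset.prod_boole, Finset.prod_const]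
  split_ifs <;> simp

/-- The probability of an event under `pin` counts the cylinder. -/
lemma prob_pin (ζ₀ : Config E) (F : Finset E) (A : Set (Config E)) :
    prob (pin ζ₀ F) A = ((1 / 2 : ℚ) ^ Fᶜ.card) * (cnt ζ₀ F A : ℚ) := by
  unfold prob cnt
  have : ∀ ζ : Config E, A.indicator (weight (pin ζ₀ F)) ζ =
      if (ζ ∈ (fib ζ₀ F).filter fun ζ => ζ ∈ A) then ((1 / 2 : ℚ) ^ Fᶜ.card) else 0 := by
    intro ζ; simp only [Set.indicator, weight_pin, fib, Finset.mem_filter, Finset.mem_univ, true_and]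
    split_ifs <;> simp_all
  rw [Finset.sum_congr rfl fun ζ _ => this ζ, Finset.sum_ite_mem, Finset.univ_inter,
    Finset.sum_const, nsmul_eq_mul, mul_comm]

omit [Fintype E] [DecidableEq E] in
/-- Clearing the factor `q = 2^{-k}` from a Harris inequality (upper form). -/
lemma aux_le {q a b c t : ℚ} (hqt : q * t = 1) (ht : 0 ≤ t) (h : q * a * (q * b) ≤ q * c) :
    a * b ≤ c * t := by
  calc a * b = (q * a * (q * b)) * (t * t) := by
        rw [show (q * a * (q * b)) * (t * t) = (q * t) * (q * t) * (a * b) by ring, hqt]; ring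
    _ ≤ (q * c) * (t * t) := mul_le_mul_of_nonneg_right h (by positivity)
    _ = c * t := by rw [show (q * c) * (t * t) = (q * t) * (c * t) by ring, hqt]; ring

omit [Fintype E] [DecidableEq E] in
/-- Clearing the factor `q = 2^{-k}` from a Harris inequality (mixed form). -/
lemma aux_ge {q a b c t : ℚ} (hqt : q * t = 1) (ht : 0 ≤ t) (h : q * c ≤ q * a * (q * b)) :
    c * t ≤ a * b := by
  calc c * t = (q * c) * (t * t) := by rw [show (q * c) * (t * t) = (q * t) * (c * t) by ring, hqt]; ring
    _ ≤ (q * a * (q * b)) * (t * t) := mul_le_mul_of_nonneg_right h (by positivity)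
    _ = a * b := by
        rw [show (q * a * (q * b)) * (t * t) = (q * t) * (q * t) * (a * b) by ring, hqt]; ring

/-- `2^{-k} · 2^k = 1`. -/
lemma half_pow_mul_two_pow (k : ℕ) : ((1 / 2 : ℚ) ^ k) * (2 : ℚ) ^ k = 1 := by
  rw [← mul_pow]; norm_num

/-- **Harris on a cylinder, counting form** (both events increasing):
`#(fib ∩ X) · #(fib ∩ Y) ≤ #(fib ∩ X ∩ Y) · 2^{|Fᶜ|}`. -/
theorem cnt_mul_cnt_le_of_upper (ζ₀ : Config E) (F : Finset E) {X Y : Set (Config E)}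
    (hX : IsUpperSet X) (hY : IsUpperSet Y) :
    cnt ζ₀ F X * cnt ζ₀ F Y ≤ cnt ζ₀ F (X ∩ Y) * 2 ^ Fᶜ.card := by
  have h := prob_mul_prob_le_prob_inter (isProbVec_pin ζ₀ F) hX hY
  rw [prob_pin, prob_pin, prob_pin] at h
  exact_mod_cast aux_le (half_pow_mul_two_pow Fᶜ.card) (by positivity) h

/-- **Harris on a cylinder, mixed form** (`X` decreasing, `Y` increasing):
`#(fib ∩ X ∩ Y) · 2^{|Fᶜ|} ≤ #(fib ∩ X) · #(fib ∩ Y)`. -/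
theorem cnt_le_cnt_mul_cnt_of_lower (ζ₀ : Config E) (F : Finset E) {X Y : Set (Config E)}
    (hX : IsLowerSet X) (hY : IsUpperSet Y) :
    cnt ζ₀ F (X ∩ Y) * 2 ^ Fᶜ.card ≤ cnt ζ₀ F X * cnt ζ₀ F Y := by
  have h := prob_inter_le_prob_mul_prob_of_isLowerSet (isProbVec_pin ζ₀ F) hX hY
  rw [prob_pin, prob_pin, prob_pin] at h
  exact_mod_cast aux_ge (half_pow_mul_two_pow Fᶜ.card) (by positivity) h

/-! ## The classes: the datum of the blue cluster of `h` -/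
variable (ends : E → Sym2 V)

/-- The edges touching the blue cluster of `h`, as a Finset. -/
noncomputable def touchF (h : V) (ζ : Config E) : Finset E :=
  Finset.univ.filter fun e => e ∈ touches ends (cluster ends (blue ζ) h)

/-- The DATUM of `ζ` at `h`: its colouring on the edges touching `C_B(h)`, blue elsewhere.  Two
configurations have the same datum iff they agree on the edges touching the blue cluster of `h`. -/
noncomputable def datum (h : V) (ζ : Config E) : Config E :=
  fun e => if e ∈ touches ends (cluster ends (blue ζ) h) then ζ e else false

/-- The colour swap OFF the edges touching `S`. -/
noncomputable def swapOff (S : Set V) (ζ : Config E) : Config E :=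
  fun e => if e ∈ touches ends S then ζ e else !ζ e

variable {ends}

omit [Fintype E] [DecidableEq E] in
/-- Domain Markov: agreeing on the edges touching `S = C_B(h)(ζ₀)` fixes the blue cluster of `h`. -/
lemma cluster_blue_eq_of_agree {h : V} {ζ ζ₀ : Config E}
    (hag : ∀ e ∈ touches ends (cluster ends (blue ζ₀) h), ζ e = ζ₀ e) :
    cluster ends (blue ζ) h = cluster ends (blue ζ₀) h :=
  cluster_eq_of_eqOn_touches (ω := blue ζ₀) (ω' := blue ζ)
    (fun e he => by simp only [blue_apply, hag e he]) rfl

omit [Fintype E] [DecidableEq E] in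
/-- The datum has the same blue cluster of `h`. -/
lemma cluster_blue_datum (h : V) (ζ : Config E) :
    cluster ends (blue (datum ends h ζ)) h = cluster ends (blue ζ) h :=
  cluster_blue_eq_of_agree fun e he => by simp only [datum, he, if_true]

omit [Fintype E] [DecidableEq E] in
/-- Two configurations have the same datum iff they agree on the edges touching `C_B(h)` of
(either of) them. -/
lemma datum_eq_iff {h : V} {ζ ζ₀ : Config E} :
    datum ends h ζ = datum ends h ζ₀ ↔
      ∀ e ∈ touches ends (cluster ends (blue ζ₀) h), ζ e = ζ₀ e := by
  constructor
  · intro hd e he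
    have hS : cluster ends (blue ζ) h = cluster ends (blue ζ₀) h := by
      have := congrArg (fun d => cluster ends (blue d) h) hd
      simpa only [cluster_blue_datum] using this
    have h1 := congrFun hd e
    simp only [datum, hS, he, if_true] at h1
    exact h1
  · intro hag
    have hS := cluster_blue_eq_of_agree hag
    funext e
    simp only [datum, hS]
    split_ifs with he
    · exact hag e he
    · rfl

/-- The cylinder of the datum. -/
lemma mem_fib_touchF {h : V} {ζ ζ₀ : Config E} :
    ζ ∈ fib ζ₀ (touchF ends h ζ₀) ↔
      ∀ e ∈ touches ends (cluster ends (blue ζ₀) h), ζ e = ζ₀ e := by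
  simp only [fib, touchF, Finset.mem_filter, Finset.mem_univ, true_and]

omit [Fintype E] [DecidableEq E] in
/-- `swapOff` is an involution. -/
lemma swapOff_swapOff (S : Set V) (ζ : Config E) : swapOff ends S (swapOff ends S ζ) = ζ := by
  funext e; by_cases he : e ∈ touches ends S <;> simp [swapOff, he]

omit [Fintype E] [DecidableEq E] in
/-- `swapOff` keeps the edges touching `S`. -/
lemma swapOff_of_mem {S : Set V} {ζ : Config E} {e : E} (he : e ∈ touches ends S) :
    swapOff ends S ζ e = ζ e := by
  simp [swapOff, he]

omit [Fintype E] [DecidableEq E] in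
/-- `swapOff` is the blue colouring off the edges touching `S`. -/
lemma swapOff_of_notMem {S : Set V} {ζ : Config E} {e : E} (he : e ∉ touches ends S) :
    swapOff ends S ζ e = blue ζ e := by
  simp [swapOff, he, blue_apply]

omit [Fintype E] [DecidableEq E] in
/-- **A blue path from `l ∉ C_B(h)` turns red under the swap off `C_B(h)`**: it never touches the
blue cluster of `h`. -/
lemma conn_swapOff_of_conn_blue {h l o : V} {ζ : Config E} {S : Set V}
    (hS : cluster ends (blue ζ) h = S) (hl : l ∉ S) (hc : Conn ends (blue ζ) l o) :
    Conn ends (swapOff ends S ζ) l o := by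
  subst hS
  exact conn_of_eqOn_off_touches (l := h) (le_refl _) hl
    (fun e he => swapOff_of_notMem he) hc

/-! ## The three events -/
/-- `{o ∈ C_B(l)}`. -/
def blueConnEvent (l o : V) : Set (Config E) := {ζ | Conn ends (blue ζ) l o}

omit [Fintype E] [DecidableEq E] in
/-- `{o ∈ C_B(l)}` is decreasing (in red). -/
lemma isLowerSet_blueConnEvent (l o : V) : IsLowerSet (blueConnEvent (ends := ends) l o) := by
  intro a b hba ha
  have hle : blue a ≤ blue b := by
    intro e
    have := hba e
    simp only [blue_apply]
    revert this
    cases a e <;> cases b e <;> simp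
  exact conn_mono hle ha

/-- **The swap injection on a class**: on the cylinder of a datum with `l ∉ S`,
`#{o ∈ C_B(l)} ≤ #{o ∈ C_R(l)}`. -/
theorem cnt_blueConn_le_cnt_conn {h l o : V} (ζ₀ : Config E)
    (hl : l ∉ cluster ends (blue ζ₀) h) :
    cnt ζ₀ (touchF ends h ζ₀) (blueConnEvent (ends := ends) l o) ≤
      cnt ζ₀ (touchF ends h ζ₀) (connEvent ends l o) := by
  unfold cnt
  refine Finset.card_le_card_of_injOn (swapOff ends (cluster ends (blue ζ₀) h)) ?_ ?_
  · intro ζ hζ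
    rw [Finset.mem_coe, Finset.mem_filter, mem_fib_touchF] at hζ
    rw [Finset.mem_coe, Finset.mem_filter, mem_fib_touchF]
    refine ⟨fun e he => ?_, ?_⟩
    · rw [swapOff_of_mem he]; exact hζ.1 e he
    · have hS := cluster_blue_eq_of_agree hζ.1
      exact conn_swapOff_of_conn_blue hS hl hζ.2
  · intro ζ₁ _ ζ₂ _ h12
    have := congrArg (swapOff ends (cluster ends (blue ζ₀) h)) h12
    simpa only [swapOff_swapOff] using this

/-- **The class inequality**: on the cylinder of a datum with `l ∉ S`,
`#{o ∈ C_B(l), h ∈ C_R(l)} ≤ #{o ∈ C_R(l), h ∈ C_R(l)}` (Harris twice + the swap). -/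
theorem cnt_class_le {h l o : V} (ζ₀ : Config E) (hl : l ∉ cluster ends (blue ζ₀) h) :
    cnt ζ₀ (touchF ends h ζ₀) (blueConnEvent (ends := ends) l o ∩ connEvent ends l h) ≤
      cnt ζ₀ (touchF ends h ζ₀) (connEvent ends l o ∩ connEvent ends l h) := by
  set F := touchF ends h ζ₀
  have h1 := cnt_le_cnt_mul_cnt_of_lower ζ₀ F (isLowerSet_blueConnEvent (ends := ends) l o)
    (isUpperSet_connEvent ends l h)
  have h2 := cnt_blueConn_le_cnt_conn (ends := ends) (o := o) ζ₀ hl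
  have h3 := cnt_mul_cnt_le_of_upper ζ₀ F (isUpperSet_connEvent ends l o)
    (isUpperSet_connEvent ends l h)
  have hpos : 0 < 2 ^ Fᶜ.card := by positivity
  refine Nat.le_of_mul_le_mul_right ?_ hpos
  calc cnt ζ₀ F (blueConnEvent (ends := ends) l o ∩ connEvent ends l h) * 2 ^ Fᶜ.card
      ≤ cnt ζ₀ F (blueConnEvent (ends := ends) l o) * cnt ζ₀ F (connEvent ends l h) := h1
    _ ≤ cnt ζ₀ F (connEvent ends l o) * cnt ζ₀ F (connEvent ends l h) :=
        Nat.mul_le_mul_right _ h2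
    _ ≤ cnt ζ₀ F (connEvent ends l o ∩ connEvent ends l h) * 2 ^ Fᶜ.card := h3

/-! ## Summing over the classes -/
omit [Fintype E] [DecidableEq E] in
/-- On a class the status `h ∈ C_B(l)` is constant. -/
lemma conn_blue_lh_iff_of_agree {h l : V} {ζ ζ₀ : Config E}
    (hag : ∀ e ∈ touches ends (cluster ends (blue ζ₀) h), ζ e = ζ₀ e) :
    Conn ends (blue ζ) l h ↔ Conn ends (blue ζ₀) l h := by
  have hS := cluster_blue_eq_of_agree hag
  have e1 : ∀ ω : Config E, Conn ends (blue ω) l h ↔ l ∈ cluster ends (blue ω) h := fun ω => by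
    simp only [mem_cluster]; exact ⟨conn_symm, conn_symm⟩
  rw [e1, e1, hS]

/-- **The one-sided side inequality** (for EVERY family `𝓥` of vertex sets):
`#{o ∈ C_B(l), h ∈ C_R(l) ∖ C_B(l), C_B(h) ∈ 𝓥} ≤ #{o ∈ C_R(l), h ∈ C_R(l) ∖ C_B(l), C_B(h) ∈ 𝓥}`. -/
theorem card_oneSided_le (l h o : V) (𝓥 : Set (Set V)) :
    (Finset.univ.filter fun ζ : Config E =>
        o ∈ cluster ends (blue ζ) l ∧ h ∈ cluster ends ζ l ∧ h ∉ cluster ends (blue ζ) l ∧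
          cluster ends (blue ζ) h ∈ 𝓥).card ≤
      (Finset.univ.filter fun ζ : Config E =>
        o ∈ cluster ends ζ l ∧ h ∈ cluster ends ζ l ∧ h ∉ cluster ends (blue ζ) l ∧
          cluster ends (blue ζ) h ∈ 𝓥).card := by
  rw [Finset.card_eq_sum_card_fiberwise (f := datum ends h) (t := (Finset.univ : Finset (Config E)))
      (fun _ _ => Finset.mem_univ _),
    Finset.card_eq_sum_card_fiberwise (f := datum ends h) (t := (Finset.univ : Finset (Config E)))
      (fun _ _ => Finset.mem_univ _)]
  refine Finset.sum_le_sum fun d _ => ?_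
  by_cases hne : ((Finset.univ.filter fun ζ : Config E =>
      o ∈ cluster ends (blue ζ) l ∧ h ∈ cluster ends ζ l ∧ h ∉ cluster ends (blue ζ) l ∧
        cluster ends (blue ζ) h ∈ 𝓥).filter fun ζ => datum ends h ζ = d) = ∅
  · rw [hne, Finset.card_empty]; exact Nat.zero_le _
  obtain ⟨ζ₀, hζ₀⟩ := Finset.nonempty_iff_ne_empty.2 hne
  rw [Finset.mem_filter, Finset.mem_filter] at hζ₀
  obtain ⟨⟨_, _, _, hhB, hV⟩, hd⟩ := hζ₀
  have hl : l ∉ cluster ends (blue ζ₀) h := by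
    simp only [mem_cluster] at hhB ⊢
    exact fun hc => hhB (conn_symm hc)
  -- both classes are cylinders of the datum of `ζ₀`
  have e1 : ((Finset.univ.filter fun ζ : Config E =>
      o ∈ cluster ends (blue ζ) l ∧ h ∈ cluster ends ζ l ∧ h ∉ cluster ends (blue ζ) l ∧
        cluster ends (blue ζ) h ∈ 𝓥).filter fun ζ => datum ends h ζ = d).card =
      cnt ζ₀ (touchF ends h ζ₀) (blueConnEvent (ends := ends) l o ∩ connEvent ends l h) := by
    unfold cnt
    congr 1
    ext ζ
    simp only [Finset.mem_filter, Finset.mem_univ, true_and, mem_fib_touchF, ← hd, datum_eq_iff,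
      Set.mem_inter_iff, blueConnEvent, connEvent, Set.mem_setOf_eq, mem_cluster]
    constructor
    · rintro ⟨⟨h1, h2, _, _⟩, hag⟩
      exact ⟨hag, h1, h2⟩
    · rintro ⟨hag, h1, h2⟩
      refine ⟨⟨h1, h2, ?_, ?_⟩, hag⟩
      · rw [conn_blue_lh_iff_of_agree hag]; simpa only [mem_cluster] using hhB
      · rw [cluster_blue_eq_of_agree hag]; exact hV
  have e2 : ((Finset.univ.filter fun ζ : Config E =>
      o ∈ cluster ends ζ l ∧ h ∈ cluster ends ζ l ∧ h ∉ cluster ends (blue ζ) l ∧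
        cluster ends (blue ζ) h ∈ 𝓥).filter fun ζ => datum ends h ζ = d).card =
      cnt ζ₀ (touchF ends h ζ₀) (connEvent ends l o ∩ connEvent ends l h) := by
    unfold cnt
    congr 1
    ext ζ
    simp only [Finset.mem_filter, Finset.mem_univ, true_and, mem_fib_touchF, ← hd, datum_eq_iff,
      Set.mem_inter_iff, connEvent, Set.mem_setOf_eq, mem_cluster]
    constructor
    · rintro ⟨⟨h1, h2, _, _⟩, hag⟩
      exact ⟨hag, h1, h2⟩
    · rintro ⟨hag, h1, h2⟩
      refine ⟨⟨h1, h2, ?_, ?_⟩, hag⟩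
      · rw [conn_blue_lh_iff_of_agree hag]; simpa only [mem_cluster] using hhB
      · rw [cluster_blue_eq_of_agree hag]; exact hV
  rw [e1, e2]
  exact cnt_class_le (ends := ends) (o := o) ζ₀ hl

/-- **Row (SW-side)**: `#{o ∈ R_side, h ∈ B_side, C_R(h) ∈ 𝓥} ≤ #{o ∈ R_side, h ∈ R_side, C_B(h) ∈ 𝓥}`
for every family `𝓥` — the switch form of the weight-free base with `h` on a SIDE of the hull of `l`
is a theorem (the open row (SW) is the same statement with `h ∉ H_l`). -/
theorem card_side_le (l h o : V) (𝓥 : Set (Set V)) :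
    (Finset.univ.filter fun ζ : Config E =>
        o ∈ rside ends ζ l ∧ h ∈ bside ends ζ l ∧ cluster ends ζ h ∈ 𝓥).card ≤
      (Finset.univ.filter fun ζ : Config E =>
        o ∈ rside ends ζ l ∧ h ∈ rside ends ζ l ∧ cluster ends (blue ζ) h ∈ 𝓥).card := by
  -- step 1: the colour swap moves the left side to `{o ∈ B_side, h ∈ R_side, C_B(h) ∈ 𝓥}`
  have step1 : (Finset.univ.filter fun ζ : Config E =>
        o ∈ rside ends ζ l ∧ h ∈ bside ends ζ l ∧ cluster ends ζ h ∈ 𝓥).card ≤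
      (Finset.univ.filter fun ζ : Config E =>
        o ∈ bside ends ζ l ∧ h ∈ rside ends ζ l ∧ cluster ends (blue ζ) h ∈ 𝓥).card := by
    refine Finset.card_le_card_of_injOn blue ?_ ?_
    · intro ζ hζ
      rw [Finset.mem_coe, Finset.mem_filter] at hζ
      rw [Finset.mem_coe, Finset.mem_filter, bside_blue, rside_blue, blue_blue]
      exact ⟨Finset.mem_univ _, hζ.2⟩
    · intro ζ₁ _ ζ₂ _ h12
      have := congrArg blue h12
      simpa only [blue_blue] using this
  refine step1.trans ?_
  -- step 2: remove the common part `o ∈ A ∩ B` from both sides of `card_oneSided_le`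
  have key := card_oneSided_le (ends := ends) l h o 𝓥
  have splitL := Finset.card_filter_add_card_filter_not
    (s := Finset.univ.filter fun ζ : Config E =>
        o ∈ cluster ends (blue ζ) l ∧ h ∈ cluster ends ζ l ∧ h ∉ cluster ends (blue ζ) l ∧
          cluster ends (blue ζ) h ∈ 𝓥) (fun ζ => o ∈ cluster ends ζ l)
  have splitR := Finset.card_filter_add_card_filter_not
    (s := Finset.univ.filter fun ζ : Config E =>
        o ∈ cluster ends ζ l ∧ h ∈ cluster ends ζ l ∧ h ∉ cluster ends (blue ζ) l ∧
          cluster ends (blue ζ) h ∈ 𝓥) (fun ζ => o ∈ cluster ends (blue ζ) l)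
  have eK : ((Finset.univ.filter fun ζ : Config E =>
        o ∈ cluster ends (blue ζ) l ∧ h ∈ cluster ends ζ l ∧ h ∉ cluster ends (blue ζ) l ∧
          cluster ends (blue ζ) h ∈ 𝓥).filter fun ζ => o ∈ cluster ends ζ l) =
      ((Finset.univ.filter fun ζ : Config E =>
        o ∈ cluster ends ζ l ∧ h ∈ cluster ends ζ l ∧ h ∉ cluster ends (blue ζ) l ∧
          cluster ends (blue ζ) h ∈ 𝓥).filter fun ζ => o ∈ cluster ends (blue ζ) l) := by
    ext ζ; simp only [Finset.mem_filter, Finset.mem_univ, true_and]; tauto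
  have eL : ((Finset.univ.filter fun ζ : Config E =>
        o ∈ cluster ends (blue ζ) l ∧ h ∈ cluster ends ζ l ∧ h ∉ cluster ends (blue ζ) l ∧
          cluster ends (blue ζ) h ∈ 𝓥).filter fun ζ => ¬ o ∈ cluster ends ζ l) =
      (Finset.univ.filter fun ζ : Config E =>
        o ∈ bside ends ζ l ∧ h ∈ rside ends ζ l ∧ cluster ends (blue ζ) h ∈ 𝓥) := by
    ext ζ; simp only [Finset.mem_filter, Finset.mem_univ, true_and, mem_bside_iff, mem_rside_iff]
    tauto
  have eR : ((Finset.univ.filter fun ζ : Config E =>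
        o ∈ cluster ends ζ l ∧ h ∈ cluster ends ζ l ∧ h ∉ cluster ends (blue ζ) l ∧
          cluster ends (blue ζ) h ∈ 𝓥).filter fun ζ => ¬ o ∈ cluster ends (blue ζ) l) =
      (Finset.univ.filter fun ζ : Config E =>
        o ∈ rside ends ζ l ∧ h ∈ rside ends ζ l ∧ cluster ends (blue ζ) h ∈ 𝓥) := by
    ext ζ; simp only [Finset.mem_filter, Finset.mem_univ, true_and, mem_rside_iff]; tauto
  rw [eK, eL] at splitL
  rw [eR] at splitR
  omega

end SwSide

end Summit.Ventures.PercRepro2
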